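import Mathlib.Analysis.SpecialFunctions.Complex.LogDeriv
import Mathlib.Analysis.SpecialFunctions.Complex.Arg
import HarnessLib

/-!
# Smooth periodic functions of the polar angle are smooth away from the origin

Topic `Literature/Analysis/SpecialFunctions`. The principal argument `Complex.arg` is real-analytic
on the slit plane `ℂ ∖ (-∞, 0]` (it is `Im log`) but jumps by `2π` across the negative real axis; a
`2π`-PERIODIC function `g` does not see the jump, so `z ↦ g(arg z)` is as smooth as `g` on all of
`ℂ ∖ {0}`. This is the form in which angular cutoffs `ζ(θ)` on the circle (e.g. the sector
partitions of unity of multiscale analysis, Benfatto–Giuliani–Mastropietro 2006 (2.45)–(2.46):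
"`F_{h,ω}(k) = f_h(k) ζ_{h,ω}(θ)`, where `θ` is the polar angle of `k`") become smooth functions of
the momentum. PROVED here:

* `contDiffAt_arg_of_mem_slitPlane` — `arg` is `C^n` (every `n`, including `ω`) on the slit plane;
* `arg_neg_add_pi_eventuallyEq` — near a point of the negative real axis, `g(arg(-w) + π) = g(arg w)`
  for `2π`-periodic `g`;
* `ContDiff.contDiffAt_comp_arg` — for `g` `C^n` and `2π`-periodic and `z ≠ 0`,
  `w ↦ g(arg w)` is `C^n` at `z`; `ContDiff.contDiffOn_comp_arg` on `{z ≠ 0}`.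

[folklore]

## References

* Mathlib `Complex.contDiffAt_log` (holomorphic logarithm on the slit plane),
  `Complex.arg_neg_eq_arg_sub_pi_of_im_pos`, `Complex.arg_neg_eq_arg_add_pi_of_im_neg`.
* G. Benfatto, A. Giuliani, V. Mastropietro, Ann. Henri Poincaré 7 (2006) 809–898, (2.45)–(2.46)
  (the use case). [BenfattoGiulianiMastropietro2006]
-/

noncomputable section

open Complex Set Filter
open scoped Topology Real

namespace Literature.Analysis.SpecialFunctions

/-- The principal argument is real-`C^n` on the slit plane, for every `n` (it is the imaginary part
of the holomorphic logarithm). [folklore] -/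
theorem contDiffAt_arg_of_mem_slitPlane {z : ℂ} (hz : z ∈ slitPlane) {n : WithTop ℕ∞} :
    ContDiffAt ℝ n arg z := by
  have h : ContDiffAt ℝ n (fun w ↦ (log w).im) z :=
    imCLM.contDiff.contDiffAt.comp z ((contDiffAt_log hz).restrict_scalars ℝ)
  exact h.congr_of_eventuallyEq (Eventually.of_forall fun w ↦ (log_im w).symm)

variable {E : Type*} {g : ℝ → E}

/-- Across the negative real axis a `2π`-periodic function of the argument can be computed from the
argument of the opposite point: near `z` with `re z < 0`, `g(arg w) = g(arg(-w) + π)`. [folklore] -/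
theorem arg_neg_add_pi_eventuallyEq (hper : Function.Periodic g (2 * Real.pi)) {z : ℂ} (hz : z.re < 0) :
    (fun w => g (arg w)) =ᶠ[𝓝 z] fun w => g (arg (-w) + Real.pi) := by
  have hopen : IsOpen {w : ℂ | w.re < 0} := isOpen_lt continuous_re continuous_const
  filter_upwards [hopen.mem_nhds hz] with w hw
  rcases lt_trichotomy w.im 0 with him | him | him
  · -- lower half plane: `arg(-w) = arg w + π`, and `g(arg w + 2π) = g(arg w)`
    rw [arg_neg_eq_arg_add_pi_of_im_neg him, add_assoc, ← two_mul, hper]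
  · -- negative real axis: `arg w = π`, `arg(-w) = 0`
    have hw' : w = (w.re : ℂ) := by rw [← re_add_im w, him]; simp
    have h1 : arg w = Real.pi := by rw [hw']; exact arg_ofReal_of_neg hw
    have hw0 : w.re < 0 := hw
    have h2 : arg (-w) = 0 := by
      rw [hw', ← ofReal_neg]; exact arg_ofReal_of_nonneg (by linarith)
    simp only [h1, h2, zero_add]
  · -- upper half plane: `arg(-w) = arg w - π`
    rw [arg_neg_eq_arg_sub_pi_of_im_pos him, sub_add_cancel]

/-- **A smooth `2π`-periodic function of the polar angle is smooth away from the origin.** [folklore] -/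
theorem _root_.ContDiff.contDiffAt_comp_arg [NormedAddCommGroup E] [NormedSpace ℝ E] {n : WithTop ℕ∞}
    (hg : ContDiff ℝ n g) (hper : Function.Periodic g (2 * Real.pi)) {z : ℂ} (hz : z ≠ 0) :
    ContDiffAt ℝ n (fun w => g (arg w)) z := by
  by_cases hs : z ∈ slitPlane
  · exact hg.contDiffAt.comp z (contDiffAt_arg_of_mem_slitPlane hs)
  · -- `z` is on the negative real axis
    rw [mem_slitPlane_iff, not_or, not_lt] at hs
    have hre : z.re < 0 := lt_of_le_of_ne hs.1 fun h => by
      apply hz; apply Complex.ext <;> simp [h, not_not.1 hs.2]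
    have hneg : -z ∈ slitPlane := Or.inl (by simpa using hre)
    refine ContDiffAt.congr_of_eventuallyEq ?_ (arg_neg_add_pi_eventuallyEq hper hre)
    exact hg.contDiffAt.comp z
      (((contDiffAt_arg_of_mem_slitPlane hneg).comp z contDiff_neg.contDiffAt).add contDiffAt_const)

/-- The same on the whole punctured plane. [folklore] -/
theorem _root_.ContDiff.contDiffOn_comp_arg [NormedAddCommGroup E] [NormedSpace ℝ E] {n : WithTop ℕ∞}
    (hg : ContDiff ℝ n g) (hper : Function.Periodic g (2 * Real.pi)) :
    ContDiffOn ℝ n (fun w => g (arg w)) {z : ℂ | z ≠ 0} := fun _ hz =>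
  (hg.contDiffAt_comp_arg hper hz).contDiffWithinAt

end Literature.Analysis.SpecialFunctions

end
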